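import Summits.KontsevichZagierPeriods.KontsevichZagierPeriods.Theorems.ZagierDilogarithmConjecture.Negative.DehnInvariant

/-!
# `ZagierDilogarithmConjecture` (stmt-KontsevichZagierPeriods-10550) — negative knowledge V: symbols from characters vanishing on the positive reals

Towards "the conjugation relators `[w] + [w̄]` are load-bearing": for additive characters
`u, v : ℂˣ → ℚ` that VANISH ON THE POSITIVE REALS, the plain (not anti-symmetrised) symbol
`sym u v` (Part II) kills the real points (`sym_eq_zero_of_im_eq_zero`) and is
conjugation-invariant (`sym_conj`, since `u(w̄) = −u(w)`), so `psym u v : ℤ[ℂ] → ℚ` vanishes on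
the span `relatorsWithoutConj` of the five-term (algebraic entries) and real relators
(`psym_eq_zero_of_mem_closure`). `exists_addMonoidHom_eq_one_of_forall_smul_notMem` (verbatim the
tree's `WeightClassCharacters` lemma): characters killing a submodule with one prescribed value;
`posRealSubmodule`. Part VI (`ConjFamily`) evaluates at the mirror pair `[4+i] − [−3+i]`.
Sorry-free, axioms ⊆ {propext, Classical.choice, Quot.sound}.
-/

noncomputable section

open Complex MeasureTheory Set
open scoped ComplexConjugate

namespace Summit.KontsevichZagierPeriods.HyperbolicBloch.ZagierDilogarithmConjectureNegative

open Literature.NumberTheory.Transcendental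
open Summit.KontsevichZagierPeriods.KontsevichZagierPeriods.Theses.HyperbolicBloch
  (ZagierDilogarithmConjecture)
open Summit.KontsevichZagierPeriods.HyperbolicBloch.FiveTermTransferNegative
  (L not_isAlgebraic_L xL xL_re xL_im not_isAlgebraic_xL isAlgebraic_of_eq_rat)

/-! ## §8 The conjugation family `[w] + [w̄]` is load-bearing (cycle 2) -/

/-! ### Characters vanishing on a subgroup, with one prescribed value -/

/-- **Extension lemma, subgroup form.** If no non-zero multiple of `x₀` lies in the submodule
`N`, there is an additive map `φ : X → ℚ` with `φ(N) = 0` and `φ x₀ = 1` (line through the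
image of `x₀` in `X ⧸ N`, extended by the injectivity of `ℚ`; verbatim the tree's
`WeightClassCharacters.exists_addMonoidHom_eq_one_of_forall_smul_notMem`). [folklore] -/
theorem exists_addMonoidHom_eq_one_of_forall_smul_notMem {X : Type*} [AddCommGroup X]
    (N : Submodule ℤ X) (x₀ : X) (hx : ∀ M : ℤ, M • x₀ ∈ N → M = 0) :
    ∃ φ : X →+ ℚ, (∀ y ∈ N, φ y = 0) ∧ φ x₀ = 1 := by
  have H : ∀ c : ℤ, c • (N.mkQ x₀) = 0 → (RingHom.id ℤ) c • (1 : ℚ) = 0 := by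
    intro c hc
    have hc' : N.mkQ (c • x₀) = 0 := by rw [map_zsmul]; exact hc
    rw [Submodule.mkQ_apply, Submodule.Quotient.mk_eq_zero] at hc'
    rw [hx c hc', RingHom.id_apply, zero_smul]
  have hmem : N.mkQ x₀ ∈ (LinearPMap.mkSpanSingleton' (N.mkQ x₀) (1 : ℚ) H).domain :=
    Submodule.mem_span_singleton_self _
  obtain ⟨ψ, hψ⟩ := (Module.Baer.of_divisible ℚ).extension_property _
    (LinearPMap.mkSpanSingleton' (N.mkQ x₀) (1 : ℚ) H).domain.injective_subtype
    (LinearPMap.mkSpanSingleton' (N.mkQ x₀) (1 : ℚ) H).toFun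
  refine ⟨(ψ ∘ₗ N.mkQ).toAddMonoidHom, fun y hy => ?_, ?_⟩
  · change ψ (N.mkQ y) = 0
    rw [Submodule.mkQ_apply, (Submodule.Quotient.mk_eq_zero N).2 hy, map_zero]
  · change ψ (N.mkQ x₀) = 1
    have e := DFunLike.congr_fun hψ ⟨N.mkQ x₀, hmem⟩
    rw [LinearMap.comp_apply, Submodule.subtype_apply] at e
    rw [e]
    exact LinearPMap.mkSpanSingleton'_apply_self _ (1 : ℚ) H hmem

/-- The positive reals as an additive subgroup of `Additive ℂˣ`. -/
def posRealSubgroup : AddSubgroup (Additive ℂˣ) where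
  carrier := {x | ∃ r : ℝ, 0 < r ∧ ((Additive.toMul x : ℂˣ) : ℂ) = r}
  add_mem' := by
    rintro x y ⟨r, hr, hx⟩ ⟨s, hs, hy⟩
    refine ⟨r * s, mul_pos hr hs, ?_⟩
    rw [toMul_add, Units.val_mul, hx, hy]; push_cast; ring
  zero_mem' := ⟨1, one_pos, by simp⟩
  neg_mem' := by
    rintro x ⟨r, hr, hx⟩
    refine ⟨r⁻¹, inv_pos.mpr hr, ?_⟩
    rw [toMul_neg, Units.val_inv_eq_inv_val, hx]; push_cast; ring

/-- The positive reals as a `ℤ`-submodule of `Additive ℂˣ`. -/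
def posRealSubmodule : Submodule ℤ (Additive ℂˣ) := posRealSubgroup.toIntSubmodule

/-- Auxiliary: `mem_posRealSubmodule`. [folklore] -/
theorem mem_posRealSubmodule {x : Additive ℂˣ} :
    x ∈ posRealSubmodule ↔ ∃ r : ℝ, 0 < r ∧ ((Additive.toMul x : ℂˣ) : ℂ) = r := Iff.rfl

/-- Auxiliary: `ofMul_mk0_mem_posRealSubmodule`. [folklore] -/
theorem ofMul_mk0_mem_posRealSubmodule {r : ℝ} (hr : 0 < r) :
    Additive.ofMul (Units.mk0 (r : ℂ) (by exact_mod_cast hr.ne')) ∈ posRealSubmodule :=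
  ⟨r, hr, by simp⟩

/-- A character killing `posRealSubmodule` kills every positive real. [folklore] -/
theorem ext_ofReal_eq_zero {u : Additive ℂˣ →+ ℚ} (hu : ∀ y ∈ posRealSubmodule, u y = 0)
    {r : ℝ} (hr : 0 < r) : ext u (r : ℂ) = 0 := by
  rw [ext_of_ne u (by exact_mod_cast hr.ne')]
  exact hu _ (ofMul_mk0_mem_posRealSubmodule hr)

/-- … hence every real number. [folklore] -/
theorem ext_eq_zero_of_im_eq_zero {u : Additive ℂˣ →+ ℚ} (hu : ∀ y ∈ posRealSubmodule, u y = 0)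
    {w : ℂ} (hw : w.im = 0) : ext u w = 0 := by
  have e : w = (w.re : ℂ) := by
    apply Complex.ext <;> simp [hw]
  rcases lt_trichotomy w.re 0 with h | h | h
  · have e' : w = -((-w.re : ℝ) : ℂ) := by rw [e]; push_cast; simp
    rw [e', ext_neg u (by exact_mod_cast (neg_pos.mpr h).ne'), ext_ofReal_eq_zero hu (neg_pos.mpr h)]
  · have : w = 0 := by rw [e, h]; simp
    simp [this, ext]
  · rw [e, ext_ofReal_eq_zero hu h]

/-- … and satisfies `u(w̄) = −u(w)`. [folklore] -/
theorem ext_conj {u : Additive ℂˣ →+ ℚ} (hu : ∀ y ∈ posRealSubmodule, u y = 0) (w : ℂ) :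
    ext u (conj w) = -ext u w := by
  by_cases hw : w = 0
  · simp [hw, ext]
  · have hn : (0 : ℝ) < Complex.normSq w := Complex.normSq_pos.mpr hw
    have e : conj w = (Complex.normSq w : ℂ) / w := by
      rw [Complex.normSq_eq_conj_mul_self, mul_div_cancel_right₀ _ hw]
    rw [e, ext_div u (by exact_mod_cast hn.ne') hw, ext_ofReal_eq_zero hu hn, zero_sub]

/-- The plain symbol kills real points when `u, v` vanish on the positive reals. [folklore] -/
theorem sym_eq_zero_of_im_eq_zero {u v : Additive ℂˣ →+ ℚ} (hu : ∀ y ∈ posRealSubmodule, u y = 0)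
    (hv : ∀ y ∈ posRealSubmodule, v y = 0) {w : ℂ} (hw : w.im = 0) : sym u v w = 0 := by
  have hw' : (1 - w).im = 0 := by simp [hw]
  simp [sym, ext_eq_zero_of_im_eq_zero hu hw, ext_eq_zero_of_im_eq_zero hv hw]

/-- The plain symbol is conjugation-invariant when `u, v` vanish on the positive reals.
[folklore] -/
theorem sym_conj {u v : Additive ℂˣ →+ ℚ} (hu : ∀ y ∈ posRealSubmodule, u y = 0)
    (hv : ∀ y ∈ posRealSubmodule, v y = 0) (w : ℂ) : sym u v (conj w) = sym u v w := by
  have e : 1 - conj w = conj (1 - w) := by simp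
  simp only [sym, e, ext_conj hu, ext_conj hv]
  ring

/-- The plain-symbol invariant `ℤ[ℂ] → ℚ`, `[z] ↦ sym u v z`. -/
def psym (u v : Additive ℂˣ →+ ℚ) : FreeAbelianGroup ℂ →+ ℚ := FreeAbelianGroup.lift (sym u v)

/-- Auxiliary: `psym_of`. [folklore] -/
@[simp] theorem psym_of (u v : Additive ℂˣ →+ ℚ) (z : ℂ) :
    psym u v (FreeAbelianGroup.of z) = sym u v z := by
  simp [psym]

/-- The relators of the crux WITHOUT the conjugation family `[w] + [w̄]`. -/
def relatorsWithoutConj : Set (FreeAbelianGroup ℂ) :=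
  {c : FreeAbelianGroup ℂ | ∃ x y : ℂ, IsAlgebraic ℚ x ∧ IsAlgebraic ℚ y ∧ x ≠ 0 ∧ x ≠ 1 ∧
      y ≠ 0 ∧ y ≠ 1 ∧ x ≠ y ∧ c = FreeAbelianGroup.of x - FreeAbelianGroup.of y +
        FreeAbelianGroup.of (y / x) - FreeAbelianGroup.of ((1 - x⁻¹) / (1 - y⁻¹)) +
        FreeAbelianGroup.of ((1 - x) / (1 - y))} ∪
    {c | ∃ w : ℂ, w.im = 0 ∧ c = FreeAbelianGroup.of w}

/-- `psym u v` kills `relatorsWithoutConj` when `u, v` vanish on the positive reals. [folklore] -/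
theorem psym_eq_zero_of_mem_closure {u v : Additive ℂˣ →+ ℚ}
    (hu : ∀ y ∈ posRealSubmodule, u y = 0) (hv : ∀ y ∈ posRealSubmodule, v y = 0)
    {c : FreeAbelianGroup ℂ} (hc : c ∈ AddSubgroup.closure relatorsWithoutConj) :
    psym u v c = 0 := by
  have hle : AddSubgroup.closure relatorsWithoutConj ≤ (psym u v).ker := by
    refine (AddSubgroup.closure_le _).mpr ?_
    rintro c (⟨x, y, -, -, hx0, hx1, hy0, hy1, hxy, rfl⟩ | ⟨w, hw, rfl⟩)
    · have h1 := sym_fiveTerm u v hx0 hx1 hy0 hy1 hxy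
      simp only [SetLike.mem_coe, AddMonoidHom.mem_ker, map_add, map_sub, psym_of]
      exact h1
    · simp only [SetLike.mem_coe, AddMonoidHom.mem_ker, psym_of]
      exact sym_eq_zero_of_im_eq_zero hu hv hw
  exact hle hc

end Summit.KontsevichZagierPeriods.HyperbolicBloch.ZagierDilogarithmConjectureNegative

end
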